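/-
Origin: expansion seat `literature-prover-pub-hodgecm-cf-kudla-howe-rallis-g6-0`, handover #3 2026-08-18T11:23:20Z (`HOME/pub-hodgecm-cf-kudla-howe-rallis-g6/lean/CfKHRg6/ThetaPending.lean`, md5 9f629b73, 420 lines);
landed by the gen-8 packager in gate run 29 REPLACES the earlier landed copy of `HodgeCM/Automorphic/ThetaPending.lean` (verbatim).
-/
/-
Origin: HOME/pub-hodgecm-cf-kudla-howe-rallis/ThetaPending.lean — session
literature-prover-pub-hodgecm-cf-kudla-howe-rallis-0 (unit pub-hodgecm-cf-kudla-howe-rallis, CITED-FACT seat (4)),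
2026-08-18, answering referee 3's pre-intake advisory R3-3 (HOME/REFEREE.md): the two v1 declarations of
`HodgeCM/Literature/ThetaCorrespondence.lean` that are NOT verbatim published theorems on the hub's holdings
leave the citable layer and live here.  Intended place: `HodgeCM/Automorphic/ThetaPending.lean`; imports the
v2 `HodgeCM.Literature.ThetaCorrespondence` (for `MetaplecticSumDatum`, `HKSRestrictionDatum`) — it must be
built AFTER that file's v2 lands.
-/
/-
v4 (DOC-ONLY, 2026-08-18): HOME/pub-hodgecm-cf-kudla-howe-rallis-g5/lean/CfKHRg5/ThetaPending.lean — session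
literature-prover-pub-hodgecm-cf-kudla-howe-rallis-g5-0 (unit pub-hodgecm-cf-kudla-howe-rallis-g5, CITED-FACT seat (4) gen 5).
REPLACES the run-22 copy of `HodgeCM/Automorphic/ThetaPending.lean` (v3, body md5 7c458732); every declaration, statement and proof is
byte-identical to v3 — only docstrings gain "v4 STATUS NOTE" sentences recording that `Pending_GUsideCompatible` has been DERIVED in the
kernel since gate runs 22/24 (files `SeesawSplittingModel`, `SeesawSplittingDescent`, `Literature/MetaplecticUniqueness`), so that a
reader of this file alone is not told that an open input remains where none does.  CITED-FACTS.md § pub-hodgecm-cf-kudla-howe-rallis-g5, KHR-27.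
-/
/-
v5 (DOC-ONLY, 2026-08-18): HOME/pub-hodgecm-cf-kudla-howe-rallis-g6/lean/CfKHRg6/ThetaPending.lean — session
literature-prover-pub-hodgecm-cf-kudla-howe-rallis-g6-0 (unit pub-hodgecm-cf-kudla-howe-rallis-g6, CITED-FACT seat (4) gen 6).  REPLACES the run-27
copy (v4, body md5 781099a17f47); every declaration, statement and proof is byte-identical to v4 — the ONE edit is a "v5 STATUS NOTE"
appended to the docstring of `RallisDatum.Pending_RallisInnerProductConvergent` (§2), whose v2 wording ("PRIMARY (NOT HELD on the hub,
acq-07570 …) … NOT a verbatim published theorem on the hub's holdings … becomes citable only when [Li92] is held and matched word by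
word") has been stale since v3 / gate run 22: the module docstring's v3 paragraph already says so, the declaration's own docstring did
not.  CITED-FACTS.md § pub-hodgecm-cf-kudla-howe-rallis-g6, KHR-37.
-/
import Summits.HodgeConjecture.HodgeCM.Literature.ThetaCorrespondence_4

set_option autoImplicit false

/-!
# OPEN INPUTS of the theta-correspondence layer — NOT CITABLE (pending a held, word-by-word matched source)

This file is NOT part of `HodgeCM/Literature/`.  It holds statements that PerL v5 §§3–4 consume and that the
CITED-FACT seat could NOT match verbatim against a held published text.  Each is a `def Pending_… : Prop` over
bare carriers, exactly like the Literature records, so that consumers carry it as an EXPLICIT hypothesis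
labelled OPEN; FACTS.md lists them as open inputs (referee 3, R3-3; ABSOLUTE RULE of the cell).  What IS
printed about each of them is typed next door in `HodgeCM.Literature.Theta` and the reductions
"pending statement ⇐ printed statements + named residual" are PROVED here, so that the residue is explicit:

* `WeilProductDatum.Pending_unitaryWeilRepMultiplicative` (v1 name `WeilRepMultiplicative`, statement
  byte-identical): the unitary seesaw compatibility of PerL Lemma 3.4, tex ll. 331–337.  Reduction
  (`of_parts`): it follows from [Ku96 (**)] metaplectic tensor compatibility FOR THE SAME isomorphism `e`
  (Literature §6a gives some `e`; Kudla's is the natural one on Schrödinger models), the factorisation of theta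
  kernels through that `e` (definitional: `θ_Φ = Σ_{x ∈ 𝕏(L₀)} ω(·)Φ(x)`, `𝕏 = 𝕏₁ × 𝕏₂`, [GQT14 §11.2 display],
  [We65 n°51]), and ONE compatibility of splittings on elements, `SeesawCover.SplittingsCompatible`, which
  `splittingsCompatible_of` reduces to [HKS96, Cor. A.3] (Literature §6b, the `U(W)`-side) plus the
  `G_U`-side residual `Pending_GUsideCompatible` — itself = [HKS96 (1.14)–(1.16)] (Literature §6c, kernel lemma
  `HKSSplittingDatum.beta_sum`) + the compatibility of the Rao coordinates `Mp ≃ Sp × ℂ¹` of the doubled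
  spaces with `j̃` (Leray cocycle additive over orthogonal sums), for which NO numbered statement was located
  in a held text (searched: corpus fts/vec "Leray invariant orthogonal sum cocycle", galaxy "Leray
  cocycle|Rao cocycle" — Kudla's notes I.3–I.4 only; GAPS.md cfKHR-G1(i), pv11-A1).
* `RallisDatum.Pending_RallisInnerProductConvergent` (v1 name `RallisInnerProductConvergent`, statement
  byte-identical) + its kernel consequence `lift_ne_zero` (PerL l. 631–632): see §2 below for the citation
  status ([Li92, Thm 2.1] = acq-07570 NOT HELD at the time of v2).

v3 (2026-08-18, gen-2 seat `literature-prover-pub-hodgecm-cf-kudla-howe-rallis-g2-0`): [Li92] became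
cell-readable and its Theorem 2.1 is typed VERBATIM next door (`HodgeCM.Literature.Theta.Li92Datum.
RallisInnerProductFormula`, Literature §9 v3).  The PerL-shaped `Pending_RallisInnerProductConvergent` is kept
unchanged as the consumers' interface (audited name) and is now DERIVED (§2, `RallisDatum.ofLi92`,
`pending_of_Li92`) for the datum a `Li92Datum` induces — so as an INPUT it is no longer open: it is [Li92,
Thm 2.1] plus the D4 dictionary (metaplectic `ω_ψ`/genuine `π` ↔ PerL's `(χ_V, μ_i)`-split `ω`, measure
constants), exactly as PerL tex ll. 584–588 / 604–605 say.  §1 (`Pending_GUsideCompatible`) is unchanged and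
remains the one open input of this file ([Ku94] still not held).

v4 STATUS NOTE (2026-08-18, gen-5 seat `literature-prover-pub-hodgecm-cf-kudla-howe-rallis-g5-0`; DOC-ONLY — no declaration of this
file changed): the preceding sentence is SUPERSEDED.  `SeesawCover.Pending_GUsideCompatible` is no longer an open input of the package;
it is DERIVED in the kernel, in two steps that landed after this file: (1) `SeesawCover.pending_GUsideCompatible_of_doubledModel`
(`HodgeCM/Automorphic/SeesawSplittingModel.lean` :188, gate run 22) derives it from [Rao93, Prop. 3.7] (`HodgeCM.Literature.Theta.
RaoDirectSumDatum.StandardModelTensor`, `HodgeCM/Literature/MetaplecticDirectSum.lean` :124) and [HKS96, (1.12)–(1.19)] typed AS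
DEFINITIONS, modulo ONE residual field `DoubledModel.jt_compat` ("Kudla's `j̃` agrees with the operator tensor product `j̃^□` under
the identifications (1.17)–(1.18)"); (2) `SeesawCover.pending_GUsideCompatible_of_descent` (`HodgeCM/Automorphic/SeesawSplittingDescent.
lean` :236, gate run 24) derives `jt_compat` itself (`HKSDescent.jt_compat` :205) from the UNIQUENESS of `j̃` [MVW, Chap. 2, II.1,
Rem. (6)], which is PROVED as `HodgeCM.Literature.Theta.MetaplecticSumCovers.jUnique_of_perfect` (`HodgeCM/Literature/
MetaplecticUniqueness.lean` :301) from the ONE cited theorem `MetaplecticSumCovers.BasePerfect` (:269) = [Margulis 1991, Chap. I,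
Cor. (2.3.2)(b)]: `Sp(W)(k)` is its own commutator subgroup for every local field `k` (archimedean included).  So, as INPUTS, BOTH
`Pending_…` statements of this file are now PRINT + the labelled instantiation dictionary D4 (one place at a time; the adelic objects
are restricted products), and the "for which NO numbered statement was located" clause in the first bullet above is retired: the
cocycle fact is [Rao93, Prop. 3.7 / Thm. 4.1 (3)] and the identification of `j̃` is the kernel theorem `HKSDescent.jt_compat`.  [Ku94]
(Kudla, Israel J. Math. 87 (1994); acq-07571) remains unobtained and is NOT needed by any declaration of the package.  The audited
interface names of this file are kept unchanged because `SeesawSplittingModel` / `SeesawSplittingDescent` and the AxiomAudit list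
import them.
-/

noncomputable section

open scoped TensorProduct

universe u

namespace HodgeCM.Automorphic.ThetaPending

open HodgeCM.Literature.Theta

/-! ## 1. The unitary seesaw compatibility of PerL Lemma 3.4 (OPEN INPUT; reduction to print proved) -/

/-- **Carriers for the seesaw identity of PerL Lemma 3.4** (tex ll. 318–337): `W = W₁ ⊕ W₂` an orthogonal
sum of Hermitian spaces paired with `V₃`; `G₁ = U(W₁)(𝔸)`, `G₂ = U(W₂)(𝔸)`, `H = G_U(𝔸) = U(V₃)(𝔸)` (or their
local analogues); `S`, `S₁`, `S₂` the spaces of `ω_{W,μ_W}`, `ω_{W₁,μ₁}`, `ω_{W₂,μ₂}` (Schwartz–Bruhat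
functions on `(V₃ ⊗ W)(𝔸)`, `(V₃ ⊗ Wⱼ)(𝔸)`; Fock polynomials at the archimedean places) with the actions
`ω`, `ω₁`, `ω₂`; `θ`, `θ₁`, `θ₂` the theta kernels `Φ ↦ ((g,h) ↦ θ_Φ(g,h))` as bare functions.
(v1 of `HodgeCM/Literature/ThetaCorrespondence.lean`, moved here unchanged.) -/
structure WeilProductDatum where
  /-- `U(W₁)(𝔸)` -/
  G₁ : Type u
  /-- `U(W₂)(𝔸)` -/
  G₂ : Type u
  /-- `U(V₃)(𝔸)` -/
  H : Type u
  /-- space of `ω_{W, μ_W}` -/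
  S : Type u
  /-- space of `ω_{W₁, μ₁}` -/
  S₁ : Type u
  /-- space of `ω_{W₂, μ₂}` -/
  S₂ : Type u
  [instS : AddCommGroup S] [instMS : Module ℂ S]
  [instS₁ : AddCommGroup S₁] [instMS₁ : Module ℂ S₁]
  [instS₂ : AddCommGroup S₂] [instMS₂ : Module ℂ S₂]
  /-- `ω_{W,μ_W}` restricted to `(U(W₁) × U(W₂)) × G_U` -/
  ω : G₁ → G₂ → H → (S →ₗ[ℂ] S)
  /-- `ω_{W₁,μ₁}` -/
  ω₁ : G₁ → H → (S₁ →ₗ[ℂ] S₁)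
  /-- `ω_{W₂,μ₂}` -/
  ω₂ : G₂ → H → (S₂ →ₗ[ℂ] S₂)
  /-- theta kernel of `ω`: `θ_Φ(h, (u₁,u₂))` -/
  θ : S → H → G₁ → G₂ → ℂ
  /-- theta kernel of `ω₁` -/
  θ₁ : S₁ → H → G₁ → ℂ
  /-- theta kernel of `ω₂` -/
  θ₂ : S₂ → H → G₂ → ℂ

attribute [instance] WeilProductDatum.instS WeilProductDatum.instMS WeilProductDatum.instS₁
  WeilProductDatum.instMS₁ WeilProductDatum.instS₂ WeilProductDatum.instMS₂

namespace WeilProductDatum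

variable (D : WeilProductDatum.{u})

/-- **OPEN INPUT (not a citation).  Multiplicativity of the Weil representation of a UNITARY dual pair in
orthogonal direct sums, with theta kernels.**  This is the statement PerL v5 Lemma 3.4 uses (tex ll. 331–337:
"The Weil representations `ω_{ψ,χ_V,μ_j}` of `U(W_j) × G_U` and `ω_{ψ,χ_V,μ_W}` of `U(W) × G_U` are compatible
with the orthogonal sum `W = W₁ ⊕ W₂` when the `U(W)`-side characters agree (`χ_V` for all) and the
`G_U`-side characters multiply (`μ₁μ₂ = μ_W`): [HKS, §1], [GI, §4] (Kudla's splitting is multiplicative in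
orthogonal sums).  The theta kernels then multiply because `(V₃ ⊗ W)(L₀) = (V₃ ⊗ W₁)(L₀) × (V₃ ⊗ W₂)(L₀)`").
STATUS: no held source prints this sentence as a theorem; what is printed ([Ku96 (**)], [HKS96 Cor. A.3,
(1.14)–(1.16)]) is typed in `HodgeCM.Literature.Theta` §6a–c and `of_parts` below PROVES this statement from
those plus the residual `SeesawCover.Pending_GUsideCompatible` and the definitional kernel factorisation.
TYPING (= v1): an explicit linear isomorphism `e : S₁ ⊗ S₂ ≃ S` intertwining `ω₁ ⊗ ω₂` with `ω` on pure
tensors, AND multiplicativity of theta kernels `θ_{e(φ₁⊗φ₂)}(h,u₁,u₂) = θ_{φ₁}(h,u₁) θ_{φ₂}(h,u₂)`. -/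
def Pending_unitaryWeilRepMultiplicative : Prop :=
  ∃ e : D.S₁ ⊗[ℂ] D.S₂ ≃ₗ[ℂ] D.S,
    (∀ (g₁ : D.G₁) (g₂ : D.G₂) (h : D.H) (x₁ : D.S₁) (x₂ : D.S₂),
        e (D.ω₁ g₁ h x₁ ⊗ₜ[ℂ] D.ω₂ g₂ h x₂) = D.ω g₁ g₂ h (e (x₁ ⊗ₜ[ℂ] x₂))) ∧
    ∀ (x₁ : D.S₁) (x₂ : D.S₂) (h : D.H) (g₁ : D.G₁) (g₂ : D.G₂),
        D.θ (e (x₁ ⊗ₜ[ℂ] x₂)) h g₁ g₂ = D.θ₁ x₁ h g₁ * D.θ₂ x₂ h g₂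

/-- **The metaplectic covers behind a `WeilProductDatum`** ([HKS96, §1, pp. 950–953]: "We want to construct
the Weil representation for the dual reductive pair `U(V)`, `U(W)` in `Sp(𝕎)`, and, in particular, to be
careful about the dependence of this representation on a choice of a splitting of the restriction of the
metaplectic cover `Mp(𝕎) ⟶ Sp(𝕎)` to `U(V)` and to `U(W)`"): `M, M₁, M₂ = Mp(𝕎), Mp(𝕎₁), Mp(𝕎₂)` as groups
with Kudla's homomorphism `j̃` [Ku96 (**)]; `Ω, Ω₁, Ω₂` the Weil representations `ω_ψ` of the three
metaplectic groups; `ιW : U(W) → Mp(𝕎)` (with `incl : U(W₁) × U(W₂) ⊂ U(W)`), `ιW₁`, `ιW₂` the splittings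
`ι̃_{V₃,χ_V}` of the `U(W)`-side groups; `ιV, ιV₁, ιV₂` the splittings `ι̃_{W,μ_W}`, `ι̃_{W₁,μ₁}`, `ι̃_{W₂,μ₂}`
of `G_U = U(V₃)` into `Mp(𝕎)`, `Mp(𝕎₁)`, `Mp(𝕎₂)`. -/
structure SeesawCover where
  /-- `U(W)` -/
  G : Type u
  /-- `U(W₁) × U(W₂) ⊂ U(W)` -/
  incl : D.G₁ → D.G₂ → G
  /-- `Mp(𝕎)` -/
  M : Type u
  /-- `Mp(𝕎₁)` -/
  M₁ : Type u
  /-- `Mp(𝕎₂)` -/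
  M₂ : Type u
  [instM : Group M] [instM₁ : Group M₁] [instM₂ : Group M₂]
  /-- Kudla's `j̃ : Mp(𝕎₁) × Mp(𝕎₂) ⟶ Mp(𝕎)`, a homomorphism -/
  jt : M₁ × M₂ →* M
  /-- `ω_ψ` of `Mp(𝕎)` -/
  Ω : M → (D.S →ₗ[ℂ] D.S)
  /-- `ω_ψ^1` of `Mp(𝕎₁)` -/
  Ω₁ : M₁ → (D.S₁ →ₗ[ℂ] D.S₁)
  /-- `ω_ψ^2` of `Mp(𝕎₂)` -/
  Ω₂ : M₂ → (D.S₂ →ₗ[ℂ] D.S₂)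
  /-- `ι̃_{V₃,χ_V} : U(W) ⟶ Mp(𝕎)` -/
  ιW : G → M
  /-- `ι̃_{V₃,χ_V} : U(W₁) ⟶ Mp(𝕎₁)` -/
  ιW₁ : D.G₁ → M₁
  /-- `ι̃_{V₃,χ_V} : U(W₂) ⟶ Mp(𝕎₂)` -/
  ιW₂ : D.G₂ → M₂
  /-- `ι̃_{W,μ_W} : U(V₃) ⟶ Mp(𝕎)` -/
  ιV : D.H → M
  /-- `ι̃_{W₁,μ₁} : U(V₃) ⟶ Mp(𝕎₁)` -/
  ιV₁ : D.H → M₁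
  /-- `ι̃_{W₂,μ₂} : U(V₃) ⟶ Mp(𝕎₂)` -/
  ιV₂ : D.H → M₂

attribute [instance] SeesawCover.instM SeesawCover.instM₁ SeesawCover.instM₂

namespace SeesawCover

variable {D}
variable (C : D.SeesawCover)

/-- The `MetaplecticSumDatum` (Literature §6a carriers) underlying the cover. -/
def toMetaplecticSumDatum : MetaplecticSumDatum.{u} where
  M₁ := C.M₁
  M₂ := C.M₂
  M := C.M
  jt := fun m₁ m₂ => C.jt (m₁, m₂)
  S := D.S
  S₁ := D.S₁
  S₂ := D.S₂
  ω := C.Ω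
  ω₁ := C.Ω₁
  ω₂ := C.Ω₂

/-- The `HKSRestrictionDatum` (Literature §6b carriers) of the `U(W)`-side splittings. -/
def toHKSRestrictionDatum : HKSRestrictionDatum.{u} where
  G := C.G
  G₁ := D.G₁
  G₂ := D.G₂
  incl := C.incl
  M := C.M
  M₁ := C.M₁
  M₂ := C.M₂
  jt := fun m₁ m₂ => C.jt (m₁, m₂)
  ι := C.ιW
  ι₁ := C.ιW₁
  ι₂ := C.ιW₂

/-- DEFINITION of the Weil representations of the unitary pairs as pullbacks of `ω_ψ` along the splittings
([HKS96, §1]; [AG17, §2.8]: "Pulling back the Weil representation of `Mp(W ⊗ V)` to `G(W) × H(V)` via this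
splitting, we obtain the associated Weil representation `ω_{V,W,χ,ψ}` of `G(W) × H(V)`"):
`ω(g₁,g₂,h) = Ω(ιW(g₁,g₂) · ιV(h))`, `ωⱼ(gⱼ,h) = Ωⱼ(ιWⱼ(gⱼ) · ιVⱼ(h))`. -/
def IsPullback : Prop :=
  (∀ (g₁ : D.G₁) (g₂ : D.G₂) (h : D.H), D.ω g₁ g₂ h = C.Ω (C.ιW (C.incl g₁ g₂) * C.ιV h)) ∧
  (∀ (g₁ : D.G₁) (h : D.H), D.ω₁ g₁ h = C.Ω₁ (C.ιW₁ g₁ * C.ιV₁ h)) ∧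
  (∀ (g₂ : D.G₂) (h : D.H), D.ω₂ g₂ h = C.Ω₂ (C.ιW₂ g₂ * C.ιV₂ h))

/-- Compatibility of the splittings with `j̃` ON ELEMENTS of `U(W₁) × U(W₂) × G_U`:
`j̃(ιW₁(g₁)ιV₁(h), ιW₂(g₂)ιV₂(h)) = ιW(g₁,g₂) ιV(h)`. -/
def SplittingsCompatible : Prop :=
  ∀ (g₁ : D.G₁) (g₂ : D.G₂) (h : D.H),
    C.jt (C.ιW₁ g₁ * C.ιV₁ h, C.ιW₂ g₂ * C.ιV₂ h) = C.ιW (C.incl g₁ g₂) * C.ιV h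

/-- **OPEN INPUT (the one residual of PerL l. 333–334 after [HKS96] was read).**  `G_U`-side compatibility:
`j̃(ι̃_{W₁,μ₁}(h), ι̃_{W₂,μ₂}(h)) = ι̃_{W,μ_W}(h)` for `h ∈ U(V₃)`, `μ_W = μ₁μ₂`.  In the Rao coordinates
`Mp ≃ Sp × ℂ¹` of the doubled spaces [HKS96, (1.12)–(1.14)] the `ℂ¹`-components are `β_{W₁,μ₁}(h)`,
`β_{W₂,μ₂}(h)`, `β_{W,μ_W}(h)` and their multiplicativity IS the kernel lemma
`HodgeCM.Literature.Theta.HKSSplittingDatum.beta_sum` (from the printed (1.15)–(1.16)); what is NOT matched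
to a numbered held statement is that `j̃` reads `((g,z₁),(g,z₂)) ↦ (j(g,g), z₁z₂)` in those coordinates, i.e.
the additivity of the Leray cocycle `c_𝕐`, `𝕐 = 𝕐₁ ⊕ 𝕐₂`, over orthogonal sums of compatibly polarised
symplectic spaces ([Ku96, I.3–I.4]; [HKS96, App., Prop. A.1/(a.20) is the `U(W)`-side analogue]).
GAPS.md cfKHR-G1(i) / pv11-A1.  v4 STATUS NOTE (no statement change): NO LONGER OPEN — DERIVED in the kernel by
`SeesawCover.pending_GUsideCompatible_of_doubledModel` (SeesawSplittingModel.lean :188, run 22) and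
`SeesawCover.pending_GUsideCompatible_of_descent` (SeesawSplittingDescent.lean :236, run 24) from [Rao93, Prop. 3.7] +
[HKS96, (1.12)–(1.19)] as definitions + MVW's uniqueness of `j̃`, itself PROVED (`MetaplecticSumCovers.jUnique_of_perfect`)
from [Margulis 1991, I, Cor. (2.3.2)(b)] (`MetaplecticSumCovers.BasePerfect`); see the module docstring.  The label "OPEN INPUT"
is kept in the first line only because the declaration name (audited, imported) says `Pending_`. -/
def Pending_GUsideCompatible : Prop :=
  ∀ h : D.H, C.jt (C.ιV₁ h, C.ιV₂ h) = C.ιV h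

variable {C}

/-- **Reduction of the element-wise compatibility to print + the one residual** (kernel): [HKS96, Cor. A.3]
for the `U(W)`-side (Literature §6b, ONE `χ_V` for `W, W₁, W₂`), the `G_U`-side residual, and the fact that
`j̃` is a homomorphism. -/
theorem splittingsCompatible_of (hA3 : C.toHKSRestrictionDatum.SplittingRestricts)
    (hV : C.Pending_GUsideCompatible) : C.SplittingsCompatible := by
  intro g₁ g₂ h
  have hmul : C.jt (C.ιW₁ g₁ * C.ιV₁ h, C.ιW₂ g₂ * C.ιV₂ h)
      = C.jt (C.ιW₁ g₁, C.ιW₂ g₂) * C.jt (C.ιV₁ h, C.ιV₂ h) := by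
    rw [← map_mul]; rfl
  have hW : C.jt (C.ιW₁ g₁, C.ιW₂ g₂) = C.ιW (C.incl g₁ g₂) := (hA3 g₁ g₂).symm
  rw [hmul, hW, hV h]

/-- **PerL's unitary seesaw statement from its parts** (kernel): given the cover data, the pullback
definition of the three Weil representations, the element-wise compatibility of splittings
(`splittingsCompatible_of`), Kudla's tensor compatibility [Ku96 (**)] for an isomorphism `e` (Literature §6a
`MetaplecticSumDatum.WeilRepMultiplicative` provides one; Kudla's is the natural `S(𝕐₁) ⊗ S(𝕐₂) ≅ S(𝕐₁ ⊕ 𝕐₂)`)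
and the factorisation of the theta kernels through the same `e` (definitional, see the file docstring), the
statement `Pending_unitaryWeilRepMultiplicative` holds. -/
theorem of_parts (hpull : C.IsPullback) (hcompat : C.SplittingsCompatible)
    (e : D.S₁ ⊗[ℂ] D.S₂ ≃ₗ[ℂ] D.S)
    (hKu : ∀ (m₁ : C.M₁) (m₂ : C.M₂) (x₁ : D.S₁) (x₂ : D.S₂),
      e (C.Ω₁ m₁ x₁ ⊗ₜ[ℂ] C.Ω₂ m₂ x₂) = C.Ω (C.jt (m₁, m₂)) (e (x₁ ⊗ₜ[ℂ] x₂)))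
    (hθ : ∀ (x₁ : D.S₁) (x₂ : D.S₂) (h : D.H) (g₁ : D.G₁) (g₂ : D.G₂),
      D.θ (e (x₁ ⊗ₜ[ℂ] x₂)) h g₁ g₂ = D.θ₁ x₁ h g₁ * D.θ₂ x₂ h g₂) :
    D.Pending_unitaryWeilRepMultiplicative := by
  refine ⟨e, ?_, hθ⟩
  intro g₁ g₂ h x₁ x₂
  rw [hpull.2.1, hpull.2.2, hKu, hcompat, ← hpull.1]

/-- The hypothesis `hKu` of `of_parts` is an instance of the Literature fact's shape: if it holds for `e`,
then `MetaplecticSumDatum.WeilRepMultiplicative` holds for the underlying metaplectic datum (sanity link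
between the two files; kernel). -/
theorem weilRepMultiplicative_of (e : D.S₁ ⊗[ℂ] D.S₂ ≃ₗ[ℂ] D.S)
    (hKu : ∀ (m₁ : C.M₁) (m₂ : C.M₂) (x₁ : D.S₁) (x₂ : D.S₂),
      e (C.Ω₁ m₁ x₁ ⊗ₜ[ℂ] C.Ω₂ m₂ x₂) = C.Ω (C.jt (m₁, m₂)) (e (x₁ ⊗ₜ[ℂ] x₂))) :
    C.toMetaplecticSumDatum.WeilRepMultiplicative :=
  ⟨e, hKu⟩

end SeesawCover

end WeilProductDatum

/-! ## 2. Rallis inner product formula in Weil's convergent range, PerL's diagonal shape (OPEN INPUT) -/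

local notation "⟪" x ", " y "⟫" => @inner ℂ _ _ x y

/-- **Carriers for the Rallis inner product formula** in the shape PerL consumes it [PerL v5 tex ll. 597–609:
the three-line display ending in `c · vol([U(W_i)]) ∫_{U(W_i)(𝔸)} ⟨ω(y)φ, φ⟩ χ'(y) dy`; `= ∏_v I_v(φ_v)`]:
`G = G(U_n)(𝔸)` (PerL: `U(W_i)(𝔸) = 𝔸¹_L`), `S` the space of `ω` with its inner product, `X` the automorphic
characters / cusp forms `f` on `[G]` being lifted, `HG` the Hilbert space `L²([H])` receiving the lifts
`θ(φ, f)`, `mcInt φ f` the absolutely convergent adelic integral `∫_{G(𝔸)} ⟨ω(y)φ, φ⟩ f(y) dy` (PerL's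
orientation: `χ'(y)`, not its conjugate, against `⟨ω(y)φ, φ⟩`; [Li92, (26)]), `c` the positive constant
(Siegel–Weil constant × `vol([G])`).  (v1 of `HodgeCM/Literature/ThetaCorrespondence.lean` §9, moved here
unchanged.) -/
structure RallisDatum where
  /-- the space of `ω` -/
  S : Type u
  /-- the forms on `[G(U_n)]` being lifted -/
  X : Type u
  /-- `L²([H(V)])` -/
  HG : Type u
  [instHG₁ : NormedAddCommGroup HG]
  [instHG₂ : InnerProductSpace ℂ HG]
  /-- `(φ, f) ↦ θ(φ, f)` -/
  lift : S → X → HG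
  /-- `(φ, f) ↦ ∫_{G(𝔸)} ⟨ω(y)φ, φ⟩ f(y) dy` -/
  mcInt : S → X → ℂ
  /-- the constant `c · vol([G])` -/
  c : ℝ

attribute [instance] RallisDatum.instHG₁ RallisDatum.instHG₂

namespace RallisDatum

variable (D : RallisDatum.{u})

/-- **OPEN INPUT (not a citation).  Rallis inner product formula, Weil's convergent range, diagonal form.**
PRIMARY (NOT HELD on the hub, acq-07570; locator from PerL's bibliography and [CL24]): [Li92] J.-S. Li,
*Non-vanishing theorems for the cohomology of certain arithmetic quotients*, J. reine angew. Math. 428 (1992)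
177–217, §2, Thm 2.1 and (26)–(27): Rallis' inner product formula in the convergent range
`n > 2n' + 4ε − 2` (metaplectic formulation; PerL: "Li's case 2, `ε = ½`, `(n, n') = (3, 1)`").  HELD
SECONDARIES, AS PRINTED: [CL24 = Chao Li, arXiv:2402.12159, §2.4 Thm 2 (held TeX chunk p0006)]: "Assume that
the pair `(V, W^□)` satisfies Weil's convergence condition.  Let `π` be a cuspidal automorphic representation
of `G(𝔸)`.  Then for any `ϕᵢ = ⊗_v ϕ_{i,v} ∈ π`, `φᵢ = ⊗ φ_{i,v} ∈ 𝒮(V(𝔸)^n)` (`i = 1, 2`),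
`κ · ⟨θ_{φ₁}(ϕ₁), θ_{φ₂}(ϕ₂)⟩_H = (L(s₀ + ½, π × χ)/b_{2n}(s₀)) · ∏_v Z_v^♮(s₀, ϕ_{1,v}, ϕ_{2,v}, φ_{1,v},
φ_{2,v})`.  Here `s₀ = (m − 2n)/2`, `κ = ½` if `m > 2n` and `κ = 1` otherwise … This theorem was proved in
J.-S. Li [Li92]" — where [CL24, §2.4] `Z_v^♮(s₀, …) = ∫_{G(F_{0,v})} \overline{⟨g_v ϕ_{1,v}, ϕ_{2,v}⟩} ·
⟨g_v φ_{1,v}, φ_{2,v}⟩ dg_v` and Weil's condition [CL24, §2.3 (chunk p0005)] is "`α = 0` (i.e., `V` is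
anisotropic), or `α > 0` and `m − α > n`"; and [GQT14 = arXiv:1207.4709, Prop. 11.1(ii) + §11.5–11.6, chunks
p0033–p0034] (the same identity "in the convergent range" under the standing assumption `d(n) < m ≤ 2 d(n)`).
WHY PENDING (GAPS.md cfKHR-G0; referee 3, R3-3 (1)): [CL24] states it for `G = U(W)`, `W` the SPLIT
skew-Hermitian space of dimension `2n` (quasi-split `U(n,n)`), and [GQT14, Thm 11.3] under `d(n) < m ≤ 2d(n)`,
which for `(n, m) = (1, 3)` FAILS (`d(1) = 1`, `m = 3 > 2`); neither printed hypothesis covers PerL's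
anisotropic `U(W_i) = U(1)`, `m = 3` (Weil's range `m > 2 d(n)`), which is exactly [Li92, Thm 2.1]'s range —
so the statement below, typed in the DIAGONAL, `G`-ANISOTROPIC shape that the three sources share after
unfolding the product of local integrals into one adelic integral (PerL tex ll. 597–609: for `f ∈ X` and
factorizable `φ`, `⟨θ(φ,f), θ(φ,f)⟩ = c · ∫_{G(𝔸)} ⟨ω(y)φ, φ⟩ f(y) dy` with `c > 0`), is NOT a verbatim
published theorem on the hub's holdings.  It becomes citable (and moves back to `HodgeCM/Literature/`) only
when [Li92] is held and matched word by word.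
v5 STATUS NOTE (2026-08-18, gen-6 seat; DOC-ONLY — the statement below is byte-identical to v1–v4): the paragraph above is the v2
wording and is SUPERSEDED since v3 (gate run 22).  [Li92] IS held cell-readably (GDZ scan PPN243919689_0428 LOG_0010: OCR page texts
pp. 177–217 + page images, filed in `HodgeCM/Literature/ThetaCorrespondence.lean` §0 `LOG_0010` block and `HOME/pub-hodgecm-cf-kudla-
howe-rallis-g2/lit/`), its Theorem 2.1 (p. 183) with (26)–(27) (p. 184) and the range (22) `n > 2n' + 4ε − 2` are typed VERBATIM as
`HodgeCM.Literature.Theta.Li92Datum.RallisInnerProductFormula` / `convergentRange` (ThetaCorrespondence.lean §9, v3; locator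
certificate CITED-FACTS KHR-17; independent page reads by pv15 and adv4 gen 5 C13), and THIS statement is DERIVED for the datum a
`Li92Datum` induces: `RallisDatum.pending_of_Li92` (end of this section).  So as an INPUT of the package it is PRINT ([Li92, Thm 2.1],
Li's case 2, `ε = ½`, `(n, n') = (3, 1)`, `3 > 2`) + the labelled instantiation dictionary D4 (metaplectic `ω_ψ` / genuine `π` ↔
PerL's `(χ_V, μ_i)`-split `ω`; measure constants), exactly as PerL v5 tex ll. 584–588 / 604–606 say; "OPEN INPUT" in the title
now means only: not instantiated for the adelic objects (no seat constructs the adelic Weil representation).  The audited name is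
kept because `N31`-cluster files and `AxiomAudit` import it. -/
def Pending_RallisInnerProductConvergent : Prop :=
  0 < D.c ∧ ∀ (φ : D.S) (f : D.X), (⟪D.lift φ f, D.lift φ f⟫ : ℂ) = (D.c : ℂ) * D.mcInt φ f

variable {D}


-- port_pkg: scope closed for this part
end RallisDatum
end HodgeCM.Automorphic.ThetaPending
end
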